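import Mathlib.Topology.MetricSpace.Holder
import Mathlib.Topology.EMetricSpace.Pi
import Mathlib.Analysis.Normed.MulAction
import Mathlib.Analysis.Normed.Group.Bounded
import Mathlib.Analysis.Calculus.MeanValue
import Mathlib.Analysis.Calculus.ContDiff.Defs
import Literature.Analysis.PDE.SchauderInteriorBallAux
import HarnessLib

/-!
# Hölder-on-a-set toolkit: derivative bounds on balls, sums, products, pi/prod, Lipschitz ∘ Hölder

Topic `Literature/Analysis/FunctionSpaces`. Elementary algebra of Mathlib's `HolderOnWith C r f s`
(the `ℝ≥0∞`-valued Hölder condition of exponent `r` and constant `C` on a set `s`) that is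
missing from Mathlib — Mathlib has `HolderOnWith.comp`, `HolderOnWith.ediam_image_le`,
`HolderOnWith.mono`, `HolderWith.add`, … but no sums / products / pi-valued maps / pairs ON A SET,
and no "derivative bound on a ball ⇒ Hölder on the ball". These are used by the interior
Schauder bootstrap (Gilbarg–Trudinger 2001, §6.1 and §17.4):

* `dist_le_of_norm_fderiv_le_ball`, `holderOnWith_of_norm_fderiv_le_ball` — mean value
  inequality on an open ball and the resulting `α`-Hölder bound (`α ≤ 1`) with constant
  `B (2R)^{1-α}`;
* `le_rpow_one_sub_mul_rpow_of_le` — the elementary `d ≤ D^{1-α} d^α` for `0 ≤ d ≤ D`, `α ≤ 1`;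
* `HolderOnWith.add'`, `holderOnWith_finset_sum`, `HolderOnWith.const_mul`,
  `HolderOnWith.mul_of_bound` — sums, constant multiples and products of (bounded) real Hölder
  functions (dot-notation extensions of Mathlib's `HolderOnWith`);
* `holderOnWith_pi_iff`, `HolderOnWith.prodMk` — pi-valued maps and pairs (sup distance);
* `LipschitzOnWith.comp_holderOnWith'` — a Lipschitz map after a Hölder map (dot-notation
  extension of Mathlib's `LipschitzOnWith`);
* `exists_bound_lipschitzOnWith_of_contDiffOn` — a `C¹` map on an open set is bounded and
  Lipschitz on every compact convex subset.

The `HolderOnWith.*` / `LipschitzOnWith.*` lemmas are declared in this file's namespace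
(`Literature.Analysis.FunctionSpaces.HolderOnWith.add'`, …); after
`open Literature.Analysis.FunctionSpaces` they are available as dot notation (`hf.add' hg`).

The passage from the real inequality `dist (f x) (f y) ≤ C dist x y ^ r` to `HolderOnWith` is the
tree's `Literature.Analysis.PDE.holderOnWith_of_dist_le_rpow` (imported, not restated).

Everything is proved; there are no definitions and no named facts. Deliberately NOT here: Hölder
NORMS (see `HolderNorm.lean`, `ContDiffHolderSpace.lean` in this directory) and anything about
higher derivatives.

## References

* D. Gilbarg, N. S. Trudinger, *Elliptic Partial Differential Equations of Second Order* (2001),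
  §4.1, §6.1. [GilbargTrudinger2001]
-/

noncomputable section

open Function Metric Set
open scoped NNReal ENNReal Topology
open Literature.Analysis.PDE (holderOnWith_of_dist_le_rpow)

namespace Literature.Analysis.FunctionSpaces

/-! ### Derivative bounds on balls -/

section DerivBound

variable {E F : Type*} [NormedAddCommGroup E] [NormedSpace ℝ E] [NormedAddCommGroup F]
  [NormedSpace ℝ F]

/-- **Mean value inequality on an open ball**: a derivative bound `‖Df‖ ≤ B` on `ball x₀ R` for a
function differentiable on that ball gives `dist (f x) (f y) ≤ B * dist x y` for `x, y` in the
ball. [folklore] -/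
theorem dist_le_of_norm_fderiv_le_ball {f : E → F} {x₀ : E} {R B : ℝ}
    (hf : DifferentiableOn ℝ f (ball x₀ R)) (hB : ∀ x ∈ ball x₀ R, ‖fderiv ℝ f x‖ ≤ B)
    {x y : E} (hx : x ∈ ball x₀ R) (hy : y ∈ ball x₀ R) : dist (f x) (f y) ≤ B * dist x y := by
  have hd : ∀ z ∈ ball x₀ R, DifferentiableAt ℝ f z := fun z hz =>
    hf.differentiableAt (isOpen_ball.mem_nhds hz)
  rw [dist_eq_norm, dist_eq_norm]
  exact (convex_ball x₀ R).norm_image_sub_le_of_norm_fderiv_le hd hB hy hx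

/-- Elementary inequality behind "Lipschitz on a bounded set ⇒ Hölder": for `0 ≤ d ≤ D` and
`α ≤ 1`, `d ≤ D ^ (1 - α) * d ^ α`. [folklore] -/
theorem le_rpow_one_sub_mul_rpow_of_le {d D α : ℝ} (hd : 0 ≤ d) (hdD : d ≤ D) (hα : α ≤ 1) :
    d ≤ D ^ (1 - α) * d ^ α := by
  rcases hd.eq_or_lt with rfl | hd0
  · rcases eq_or_ne α 0 with rfl | hα0
    · simpa using hdD
    · rw [Real.zero_rpow hα0, mul_zero]
  · calc d = d ^ (1 - α) * d ^ α := by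
          rw [← Real.rpow_add hd0, sub_add_cancel, Real.rpow_one]
      _ ≤ D ^ (1 - α) * d ^ α :=
          mul_le_mul_of_nonneg_right (Real.rpow_le_rpow hd hdD (sub_nonneg.2 hα))
            (Real.rpow_nonneg hd _)

/-- **Derivative bound on a ball ⇒ Hölder on the ball.** On `ball x₀ R`, a derivative bound
`‖Df‖ ≤ B` gives, for every exponent `α ≤ 1`, the `α`-Hölder bound with constant
`B (2R)^{1-α}` (the diameter of the ball is `≤ 2R`; for `R ≤ 0` the ball is empty). [folklore] -/
theorem holderOnWith_of_norm_fderiv_le_ball {f : E → F} {x₀ : E} {R : ℝ} {B : ℝ≥0} {α : ℝ≥0}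
    (hα : α ≤ 1) (hf : DifferentiableOn ℝ f (ball x₀ R))
    (hB : ∀ x ∈ ball x₀ R, ‖fderiv ℝ f x‖ ≤ B) :
    HolderOnWith (B * (2 * R.toNNReal) ^ (1 - (α : ℝ))) α f (ball x₀ R) := by
  refine holderOnWith_of_dist_le_rpow fun x hx y hy => ?_
  have hR : 0 < R := lt_of_le_of_lt dist_nonneg (mem_ball.1 hx)
  have hxy : dist x y ≤ 2 * R := by
    calc dist x y ≤ dist x x₀ + dist y x₀ := dist_triangle_right x y x₀
      _ ≤ R + R := add_le_add (mem_ball.1 hx).le (mem_ball.1 hy).le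
      _ = 2 * R := by ring
  have hα' : (α : ℝ) ≤ 1 := by exact_mod_cast hα
  have key : dist x y ≤ (2 * R) ^ (1 - (α : ℝ)) * dist x y ^ (α : ℝ) :=
    le_rpow_one_sub_mul_rpow_of_le dist_nonneg hxy hα'
  calc dist (f x) (f y) ≤ B * dist x y := dist_le_of_norm_fderiv_le_ball hf hB hx hy
    _ ≤ B * ((2 * R) ^ (1 - (α : ℝ)) * dist x y ^ (α : ℝ)) := by gcongr
    _ = ↑(B * (2 * R.toNNReal) ^ (1 - (α : ℝ))) * dist x y ^ (α : ℝ) := by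
        rw [NNReal.coe_mul, NNReal.coe_rpow, NNReal.coe_mul, Real.coe_toNNReal R hR.le,
          NNReal.coe_ofNat, mul_assoc]

end DerivBound

/-! ### Sums, products, pi-valued maps, pairs, Lipschitz after Hölder -/

section Algebra

variable {X : Type*} [PseudoMetricSpace X] {s : Set X} {r : ℝ≥0}

/-- **Sum of Hölder functions on a set** (dot-notation extension of Mathlib's `HolderOnWith`;
Mathlib only has the global `HolderWith.add`): the constants add. [folklore] -/
theorem HolderOnWith.add' {F : Type*} [NormedAddCommGroup F] {f g : X → F} {Cf Cg : ℝ≥0}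
    (hf : HolderOnWith Cf r f s) (hg : HolderOnWith Cg r g s) :
    HolderOnWith (Cf + Cg) r (fun x => f x + g x) s := by
  intro x hx y hy
  calc edist (f x + g x) (f y + g y) ≤ edist (f x) (f y) + edist (g x) (g y) :=
        edist_add_add_le _ _ _ _
    _ ≤ Cf * edist x y ^ (r : ℝ) + Cg * edist x y ^ (r : ℝ) :=
        add_le_add (hf x hx y hy) (hg x hx y hy)
    _ = ((Cf + Cg : ℝ≥0) : ℝ≥0∞) * edist x y ^ (r : ℝ) := by rw [ENNReal.coe_add, add_mul]

/-- **Finite sum of Hölder functions on a set**: the constants add. [folklore] -/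
theorem holderOnWith_finset_sum {κ F : Type*} [NormedAddCommGroup F] (t : Finset κ)
    {f : κ → X → F} {C : κ → ℝ≥0} (h : ∀ k ∈ t, HolderOnWith (C k) r (f k) s) :
    HolderOnWith (∑ k ∈ t, C k) r (fun x => ∑ k ∈ t, f k x) s := by
  classical
  induction t using Finset.induction_on with
  | empty =>
      simp only [Finset.sum_empty]
      intro x _ y _
      rw [edist_self]
      exact bot_le
  | insert a t ha ih =>
      simp only [Finset.sum_insert ha]
      exact HolderOnWith.add' (h a (Finset.mem_insert_self a t))
        (ih fun k hk => h k (Finset.mem_insert_of_mem hk))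

/-- **Constant multiple of a real Hölder function on a set** (dot-notation extension of Mathlib's
`HolderOnWith`): the constant is multiplied by `‖c‖₊`. [folklore] -/
theorem HolderOnWith.const_mul {f : X → ℝ} {C : ℝ≥0} (hf : HolderOnWith C r f s) (c : ℝ) :
    HolderOnWith (‖c‖₊ * C) r (fun x => c * f x) s := by
  intro x hx y hy
  have h := edist_smul₀ c (f x) (f y)
  simp only [smul_eq_mul, ENNReal.smul_def] at h
  calc edist (c * f x) (c * f y) = (‖c‖₊ : ℝ≥0∞) * edist (f x) (f y) := h
    _ ≤ (‖c‖₊ : ℝ≥0∞) * (C * edist x y ^ (r : ℝ)) := by gcongr; exact hf x hx y hy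
    _ = ((‖c‖₊ * C : ℝ≥0) : ℝ≥0∞) * edist x y ^ (r : ℝ) := by rw [ENNReal.coe_mul, mul_assoc]

/-- **Product of bounded real Hölder functions on a set** (dot-notation extension of Mathlib's
`HolderOnWith`): if `|f| ≤ A`, `|g| ≤ B` on `s` then `f g` is Hölder with constant
`A Cg + B Cf`, by `f x g x - f y g y = f x (g x - g y) + (f x - f y) g y`. [folklore] -/
theorem HolderOnWith.mul_of_bound {f g : X → ℝ} {Cf Cg A B : ℝ≥0} (hf : HolderOnWith Cf r f s)
    (hg : HolderOnWith Cg r g s) (hA : ∀ x ∈ s, ‖f x‖ ≤ A) (hB : ∀ x ∈ s, ‖g x‖ ≤ B) :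
    HolderOnWith (A * Cg + B * Cf) r (fun x => f x * g x) s := by
  refine holderOnWith_of_dist_le_rpow fun x hx y hy => ?_
  have hfd : dist (f x) (f y) ≤ Cf * dist x y ^ (r : ℝ) := hf.dist_le hx hy
  have hgd : dist (g x) (g y) ≤ Cg * dist x y ^ (r : ℝ) := hg.dist_le hx hy
  rw [dist_eq_norm] at hfd hgd ⊢
  calc ‖f x * g x - f y * g y‖ = ‖f x * (g x - g y) + (f x - f y) * g y‖ := by ring_nf
    _ ≤ ‖f x * (g x - g y)‖ + ‖(f x - f y) * g y‖ := norm_add_le _ _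
    _ = ‖f x‖ * ‖g x - g y‖ + ‖f x - f y‖ * ‖g y‖ := by rw [norm_mul, norm_mul]
    _ ≤ A * (Cg * dist x y ^ (r : ℝ)) + Cf * dist x y ^ (r : ℝ) * B := by
        gcongr
        · exact hA x hx
        · exact hB y hy
    _ = ↑(A * Cg + B * Cf) * dist x y ^ (r : ℝ) := by push_cast; ring

/-- **Pi-valued maps: Hölder iff componentwise** (sup distance on a finite product), with the
same constant and exponent. [folklore] -/
theorem holderOnWith_pi_iff {κ : Type*} [Fintype κ] {F : κ → Type*}
    [∀ k, PseudoMetricSpace (F k)] {f : X → ∀ k, F k} {C : ℝ≥0} :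
    HolderOnWith C r f s ↔ ∀ k, HolderOnWith C r (fun x => f x k) s := by
  constructor
  · intro h k x hx y hy
    exact (edist_le_pi_edist (f x) (f y) k).trans (h x hx y hy)
  · intro h x hx y hy
    exact edist_pi_le_iff.2 fun k => h k x hx y hy

/-- **Pairs of Hölder maps on a set** (dot-notation extension of Mathlib's `HolderOnWith`):
`x ↦ (f x, g x)` is Hölder with constant `max Cf Cg` (sup distance on the product). [folklore] -/
theorem HolderOnWith.prodMk {Y Z : Type*} [PseudoMetricSpace Y] [PseudoMetricSpace Z] {f : X → Y}
    {g : X → Z} {Cf Cg : ℝ≥0} (hf : HolderOnWith Cf r f s) (hg : HolderOnWith Cg r g s) :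
    HolderOnWith (max Cf Cg) r (fun x => (f x, g x)) s := by
  intro x hx y hy
  rw [Prod.edist_eq]
  refine max_le ((hf x hx y hy).trans ?_) ((hg x hx y hy).trans ?_)
  · gcongr
    exact le_max_left _ _
  · gcongr
    exact le_max_right _ _

/-- **Lipschitz after Hölder on sets** (dot-notation extension of Mathlib's `LipschitzOnWith`;
Mathlib has `HolderOnWith.comp` with exponents `rg * rf` and `HolderWith.comp_holderOnWith`):
if `ψ` is `K`-Lipschitz on `t ⊇ f '' s` and `f` is `(C, r)`-Hölder on `s` then `ψ ∘ f` is
`(K C, r)`-Hölder on `s`. [folklore] -/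
theorem LipschitzOnWith.comp_holderOnWith' {Y Z : Type*} [PseudoMetricSpace Y]
    [PseudoMetricSpace Z] {ψ : Y → Z} {K : ℝ≥0} {t : Set Y} (hψ : LipschitzOnWith K ψ t)
    {f : X → Y} {C : ℝ≥0} (hf : HolderOnWith C r f s) (hst : MapsTo f s t) :
    HolderOnWith (K * C) r (ψ ∘ f) s := by
  intro x hx y hy
  calc edist (ψ (f x)) (ψ (f y)) ≤ K * edist (f x) (f y) := hψ (hst hx) (hst hy)
    _ ≤ K * (C * edist x y ^ (r : ℝ)) := by gcongr; exact hf x hx y hy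
    _ = ((K * C : ℝ≥0) : ℝ≥0∞) * edist x y ^ (r : ℝ) := by rw [ENNReal.coe_mul, mul_assoc]

end Algebra

/-! ### `C¹` maps are bounded and Lipschitz on compact convex sets -/

section Lipschitz

variable {V F : Type*} [NormedAddCommGroup V] [NormedSpace ℝ V] [NormedAddCommGroup F]
  [NormedSpace ℝ F]

/-- **A `C¹` map on an open set is bounded and Lipschitz on every compact convex subset** (the
bound from continuity on a compact set; the Lipschitz constant is the maximum of `‖DΨ‖` on the
compact set, by the mean value inequality on the convex set). [folklore] -/
theorem exists_bound_lipschitzOnWith_of_contDiffOn {Ψ : V → F} {O K : Set V} (hO : IsOpen O)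
    (hΨ : ContDiffOn ℝ 1 Ψ O) (hK : IsCompact K) (hKc : Convex ℝ K) (hKO : K ⊆ O) :
    ∃ M : ℝ, ∃ L : ℝ≥0, (∀ x ∈ K, ‖Ψ x‖ ≤ M) ∧ LipschitzOnWith L Ψ K := by
  have hcont : ContinuousOn (fun x => fderiv ℝ Ψ x) O :=
    hΨ.continuousOn_fderiv_of_isOpen hO le_rfl
  obtain ⟨C, hC⟩ := hK.exists_bound_of_continuousOn (hcont.mono hKO)
  obtain ⟨M, hM⟩ := hK.exists_bound_of_continuousOn (hΨ.continuousOn.mono hKO)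
  have hdiff : ∀ z ∈ K, DifferentiableAt ℝ Ψ z := fun z hz =>
    (hΨ.differentiableOn one_ne_zero z (hKO hz)).differentiableAt (hO.mem_nhds (hKO hz))
  refine ⟨M, C.toNNReal, hM, hKc.lipschitzOnWith_of_nnnorm_fderiv_le hdiff fun z hz => ?_⟩
  rw [← NNReal.coe_le_coe, coe_nnnorm]
  exact (hC z hz).trans (Real.le_coe_toNNReal C)

end Lipschitz

end Literature.Analysis.FunctionSpaces
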